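import Mathlib
import Literature.Computability.Complexity.RandomKSatEnsembleOGP
import Summits.PneNP.PneNP.Theorems.OverlapGapAlgebraSearchHardWindowChainMassBasic

/-!
# Route OverlapGapAlgebra, crux `SearchHardWindow` (stmt-PneNP-2460), line `Sketch`: the chaos
# first moment for ONE time tuple

Stub `stub_chaosTupleBound` of the skeleton
`Summits/PneNP/PneNP/Cruxes/SearchHardWindow/Lines/Sketch.lean` (section `Chaos`), the per-time-tuple
first moment behind the CHAOS lemma of Huang–Sellke 2025 (arXiv:2501.06427, proof of Lemma 3.23;
Bresler–Huang 2021, arXiv:2106.02129, §4.6, `P(S_indep^c)`) for random `k`-SAT on the `ε`-resampling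
chain `z 0, z 1, …` of literal arrays `V = (Fin m × Fin k → Fin n × Bool)` (vocabulary
`resampleKernel`, `resampleChainMass`, `overlapCondEnt` of
`Literature/Computability/Complexity/RandomKSatEnsembleOGP.lean`).

Fix earlier rung times `τ 0, …, τ (j-1) ≤ s`, outputs `a (z (τ ℓ))`, and the candidate time
`s + Δ ≤ K`. The event is `E z = ∃ x, Sat x (z (s+Δ)) ∧ Ent z x ≤ β` with
`Ent z x = overlapCondEnt (a (z (τ 0)), …, a (z (τ (j-1))), x, x, …) j`. The generic inputs are
hypotheses of the stub (they are the already landed theorems `stub_kernelPowPaths`,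
`stub_chainTwoBlock`, `stub_chainMassUnion`, `stub_satProbBound`, `stub_lowEntropyCount`,
`stub_chainMassTotal`.2 of the same section), and the proof is the chain
`mass E ≤ Σ_x mass (Sat_x ∧ Ent_x ≤ β) ≤ Σ_x q · mass (Ent_x ≤ β) = q · Σ_x mass (Ent_x ≤ β) ≤ q · M`
with `q = (1 − (E_Δ/2)^k)^m`, `E_Δ = 1 − (1−ε)^Δ ∈ [0, 1]`, `M = (n+1)^{2^j} e^{nβ}`:
* the union bound over the finitely many candidates `x` (`hUnion`);
* for each `x`, the two-block Markov bound (`hTwoBlock`): the entropy event only reads the path at the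
  times `τ ℓ ≤ s`, and every length-`Δ` segment started at `w` carries a satisfying endpoint with
  weight `Σ_{y'} P_{E_Δ}(w, y') [Sat x y'] ≤ q` — insert the sum over the endpoint `y'`
  (`ctu_sum_endpoint`), use the closed form of the `Δ`-step path sums (`hPow`) and the satisfaction
  probability of a fixed assignment (`hSat`) (`ctu_segment_bound`);
* the weighted count `Σ_x mass (Ent_x ≤ β) ≤ M` (`hTotal`), every path carrying at most `M` candidates
  of low conditional overlap entropy (`hCount`).
-/

set_option linter.dupNamespace false -- `Summit.PneNP.PneNP.…`: summit = sub-problem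

namespace Summit.PneNP.PneNP.Theorems

open Finset Filter Asymptotics
open Literature.Computability.Complexity
open scoped Classical

/-- **Inserting the sum over the endpoint of a segment.** For segments `y : P` with start `first y`
and end `last y`, weights `W`, and an endpoint observable `G y = g (last y)`:
`Σ_y [first y = w] W y G y = Σ_{y'} (Σ_y [first y = w ∧ last y = y'] W y) · g y'`.
Stated for arbitrary `Decidable` instances of the two indicator conditions. -/
theorem ctu_sum_endpoint {P V : Type*} {instP : Fintype P} {instV : Fintype V}
    (first last : P → V) (w : V) (W G : P → ℝ) (g : V → ℝ) (hG : ∀ y, G y = g (last y))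
    {d1 : ∀ y, Decidable (first y = w)} {d2 : ∀ y y', Decidable (first y = w ∧ last y = y')} :
    ∑ y, @ite ℝ (first y = w) (d1 y) (W y * G y) 0 =
      ∑ y', (∑ y, @ite ℝ (first y = w ∧ last y = y') (d2 y y') (W y) 0) * g y' := by
  calc ∑ y, @ite ℝ (first y = w) (d1 y) (W y * G y) 0
      = ∑ y, ∑ y', @ite ℝ (first y = w ∧ last y = y') (d2 y y') (W y) 0 * g y' := by
        refine Finset.sum_congr rfl fun y _ => ?_
        rw [Finset.sum_eq_single_of_mem (last y) (Finset.mem_univ _) ?_]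
        · rw [hG y]
          by_cases h : first y = w
          · rw [if_pos h, if_pos ⟨h, rfl⟩]
          · rw [if_neg h, if_neg (fun h' => h h'.1), zero_mul]
        · intro y' _ hy'
          rw [if_neg (fun h' => hy' h'.2.symm), zero_mul]
    _ = ∑ y', ∑ y, @ite ℝ (first y = w ∧ last y = y') (d2 y y') (W y) 0 * g y' :=
        Finset.sum_comm
    _ = ∑ y', (∑ y, @ite ℝ (first y = w ∧ last y = y') (d2 y y') (W y) 0) * g y' :=
        Finset.sum_congr rfl fun y' _ => (Finset.sum_mul _ _ _).symm

/-- **The segment bound of the two-block step.** If the segments from `w` to `y'` have total weight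
`R y'` (`hPow`, the closed form of the `Δ`-step path sums) and `Σ_{y'} R y' · g y' ≤ q` (`hSat`, the
satisfaction probability of a fixed assignment under one resampling step of rate `E_Δ`), then the
segments started at `w` carry the endpoint observable with weight `Σ_y [first y = w] W y G y ≤ q`.
Stated for arbitrary `Decidable` instances of the indicator conditions. -/
theorem ctu_segment_bound {P V : Type*} {instP : Fintype P} {instV : Fintype V}
    (first last : P → V) (w : V) (W G : P → ℝ) (g R : V → ℝ) (q : ℝ)
    {d1 : ∀ y, Decidable (first y = w)} {d2 : ∀ y y', Decidable (first y = w ∧ last y = y')}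
    (hG : ∀ y, G y = g (last y))
    (hPow : ∀ y', ∑ y, @ite ℝ (first y = w ∧ last y = y') (d2 y y') (W y) 0 = R y')
    (hSat : ∑ y', R y' * g y' ≤ q) :
    ∑ y, @ite ℝ (first y = w) (d1 y) (W y * G y) 0 ≤ q := by
  rw [ctu_sum_endpoint first last w W G g hG (d2 := d2)]
  calc ∑ y', (∑ y, @ite ℝ (first y = w ∧ last y = y') (d2 y y') (W y) 0) * g y'
      = ∑ y', R y' * g y' := Finset.sum_congr rfl fun y' _ => by rw [hPow y']
    _ ≤ q := hSat

/-- **The chaos first moment for ONE time tuple** (stub `stub_chaosTupleBound` of line `Sketch`,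
section `Chaos`; Huang–Sellke 2025, proof of Lemma 3.23 / Bresler–Huang 2021 §4.6 `P(S_indep^c)`):
earlier rung times `τ 0, …, τ (j−1) ≤ s`, candidate time `s + Δ ≤ K`; the paths carrying a candidate
`x` that satisfies the instance at time `s + Δ` and has conditional overlap entropy `≤ β` given the
outputs `a` at the earlier rung times have mass `≤ (1 − (E_Δ/2)^k)^m · (n+1)^{2^j} e^{nβ}`,
`E_Δ = 1 − (1−ε)^Δ`. The generic inputs are hypotheses: `hPow` = `stub_kernelPowPaths`,
`hTwoBlock` = `stub_chainTwoBlock`, `hUnion` = `stub_chainMassUnion`, `hSat` = `stub_satProbBound`,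
`hCount` = `stub_lowEntropyCount`, `hTotal` = `stub_chainMassTotal`.2. Proof: union bound over `x`,
two-block bound for each `x` (the entropy event reads the path only at times `≤ s`; the segment bound
is `ctu_segment_bound`), then the weighted count of low-entropy candidates. -/
theorem stub_chaosTupleBound
    (hPow : ∀ {ι Γ : Type} [Fintype ι] [DecidableEq ι] [Fintype Γ] [DecidableEq Γ] [Nonempty Γ]
      (ε : ℝ) (Δ : ℕ) (w y' : ι → Γ),
      ∑ y : Fin (Δ + 1) → ι → Γ,
          (if y 0 = w ∧ y (Fin.last Δ) = y' then
            ∏ t : Fin Δ, resampleKernel ε (y t.castSucc) (y t.succ) else 0)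
        = resampleKernel (1 - (1 - ε) ^ Δ) w y')
    (hTwoBlock : ∀ {ι Γ : Type} [Fintype ι] [DecidableEq ι] [Fintype Γ] [DecidableEq Γ] [Nonempty Γ]
      (ε : ℝ), 0 ≤ ε → ε ≤ 1 → ∀ (K s Δ : ℕ), s + Δ ≤ K → ∀ (A : (ℕ → ι → Γ) → Prop),
      (∀ z z' : ℕ → ι → Γ, (∀ t ≤ s, z t = z' t) → (A z ↔ A z')) →
      ∀ (B : (ι → Γ) → Prop) (q : ℝ),
      (∀ w : ι → Γ, ∑ y : Fin (Δ + 1) → ι → Γ,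
          (if y 0 = w then (∏ t : Fin Δ, resampleKernel ε (y t.castSucc) (y t.succ)) *
            (if B (y (Fin.last Δ)) then (1 : ℝ) else 0) else 0) ≤ q) →
      resampleChainMass ε K (fun z => A z ∧ B (z (s + Δ))) ≤ q * resampleChainMass ε K A)
    (hUnion : ∀ {ι Γ X : Type} [Fintype ι] [DecidableEq ι] [Fintype Γ] [DecidableEq Γ] [Nonempty Γ]
      [Fintype X] (ε : ℝ), 0 ≤ ε → ε ≤ 1 → ∀ (K : ℕ) (E : X → (ℕ → ι → Γ) → Prop),
      resampleChainMass ε K (fun z => ∃ x, E x z) ≤ ∑ x, resampleChainMass ε K (E x))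
    (hSat : ∀ (n m k : ℕ), 1 ≤ n → ∀ (E : ℝ), 0 ≤ E → E ≤ 1 → ∀ (x : Fin n → Bool)
      (w : Fin m × Fin k → Fin n × Bool),
      ∑ y' : Fin m × Fin k → Fin n × Bool, resampleKernel E w y' *
          (if (∀ i : Fin m, ∃ j : Fin k, x (y' (i, j)).1 = (y' (i, j)).2) then (1 : ℝ) else 0)
        ≤ (1 - (E / 2) ^ k) ^ m)
    (hCount : ∀ (n j : ℕ), 1 ≤ j → ∀ (prev : ℕ → Fin n → Bool) (β : ℝ),
      ((univ.filter fun x : Fin n → Bool =>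
          overlapCondEnt (fun ℓ => if ℓ < j then prev ℓ else x) j ≤ β).card : ℝ)
        ≤ ((n : ℝ) + 1) ^ (2 ^ j) * Real.exp (n * β))
    (hTotal : ∀ {ι Γ : Type} [Fintype ι] [DecidableEq ι] [Fintype Γ] [DecidableEq Γ] [Nonempty Γ]
      (ε : ℝ), 0 ≤ ε → ε ≤ 1 → ∀ (K : ℕ) (X : Type) [Fintype X] (E : X → (ℕ → ι → Γ) → Prop)
      (M : ℝ), (∀ z : ℕ → ι → Γ, ((univ.filter fun x : X => E x z).card : ℝ) ≤ M) →
      ∑ x : X, resampleChainMass ε K (E x) ≤ M)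
    (n m k : ℕ) (hn : 1 ≤ n) (ε : ℝ) (hε0 : 0 ≤ ε) (hε1 : ε ≤ 1)
    (K j s Δ : ℕ) (hj : 1 ≤ j) (hsΔ : s + Δ ≤ K) (τ : ℕ → ℕ) (hτ : ∀ ℓ < j, τ ℓ ≤ s)
    (a : (Fin m × Fin k → Fin n × Bool) → (Fin n → Bool)) (β : ℝ) :
    resampleChainMass ε K (fun z : ℕ → (Fin m × Fin k → Fin n × Bool) =>
        ∃ x : Fin n → Bool,
          (∀ i : Fin m, ∃ j' : Fin k, x (z (s + Δ) (i, j')).1 = (z (s + Δ) (i, j')).2) ∧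
          overlapCondEnt (fun ℓ => if ℓ < j then a (z (τ ℓ)) else x) j ≤ β)
      ≤ (1 - ((1 - (1 - ε) ^ Δ) / 2) ^ k) ^ m * (((n : ℝ) + 1) ^ (2 ^ j) * Real.exp (n * β)) := by
  -- the literal alphabet is nonempty (`n ≥ 1`)
  haveI : Nonempty (Fin n × Bool) := ⟨(⟨0, hn⟩, true)⟩
  -- the `Δ`-step resampling rate `E_Δ = 1 − (1−ε)^Δ ∈ [0, 1]` and `q = (1 − (E_Δ/2)^k)^m ≥ 0`
  have h1ε0 : (0 : ℝ) ≤ 1 - ε := sub_nonneg.mpr hε1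
  have h1ε1 : (1 : ℝ) - ε ≤ 1 := sub_le_self _ hε0
  have hE0 : (0 : ℝ) ≤ 1 - (1 - ε) ^ Δ := sub_nonneg.mpr (pow_le_one₀ h1ε0 h1ε1)
  have hE1 : (1 : ℝ) - (1 - ε) ^ Δ ≤ 1 := sub_le_self _ (pow_nonneg h1ε0 Δ)
  have hq0 : (0 : ℝ) ≤ (1 - ((1 - (1 - ε) ^ Δ) / 2) ^ k) ^ m := by
    refine pow_nonneg (sub_nonneg.mpr (pow_le_one₀ ?_ ?_)) m
    · linarith
    · linarith
  -- Step 2: for each candidate `x`, the two-block Markov bound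
  have h2 : ∀ x : Fin n → Bool,
      resampleChainMass ε K (fun z : ℕ → (Fin m × Fin k → Fin n × Bool) =>
          (∀ i : Fin m, ∃ j' : Fin k, x (z (s + Δ) (i, j')).1 = (z (s + Δ) (i, j')).2) ∧
            overlapCondEnt (fun ℓ => if ℓ < j then a (z (τ ℓ)) else x) j ≤ β)
        ≤ (1 - ((1 - (1 - ε) ^ Δ) / 2) ^ k) ^ m *
          resampleChainMass ε K (fun z : ℕ → (Fin m × Fin k → Fin n × Bool) =>
            overlapCondEnt (fun ℓ => if ℓ < j then a (z (τ ℓ)) else x) j ≤ β) := by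
    intro x
    have hev : (fun z : ℕ → (Fin m × Fin k → Fin n × Bool) =>
          (∀ i : Fin m, ∃ j' : Fin k, x (z (s + Δ) (i, j')).1 = (z (s + Δ) (i, j')).2) ∧
            overlapCondEnt (fun ℓ => if ℓ < j then a (z (τ ℓ)) else x) j ≤ β) =
        (fun z : ℕ → (Fin m × Fin k → Fin n × Bool) =>
          overlapCondEnt (fun ℓ => if ℓ < j then a (z (τ ℓ)) else x) j ≤ β ∧
            (∀ i : Fin m, ∃ j' : Fin k, x (z (s + Δ) (i, j')).1 = (z (s + Δ) (i, j')).2)) :=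
      funext fun z => propext and_comm
    rw [hev]
    refine hTwoBlock ε hε0 hε1 K s Δ hsΔ
      (fun z : ℕ → (Fin m × Fin k → Fin n × Bool) =>
        overlapCondEnt (fun ℓ => if ℓ < j then a (z (τ ℓ)) else x) j ≤ β) ?_
      (fun v : Fin m × Fin k → Fin n × Bool =>
        ∀ i : Fin m, ∃ j' : Fin k, x (v (i, j')).1 = (v (i, j')).2)
      ((1 - ((1 - (1 - ε) ^ Δ) / 2) ^ k) ^ m) ?_
    · -- the entropy event reads the path only at the times `τ ℓ ≤ s`, `ℓ < j`
      intro z z' hzz'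
      have hfun : (fun ℓ => if ℓ < j then a (z (τ ℓ)) else x) =
          (fun ℓ => if ℓ < j then a (z' (τ ℓ)) else x) := by
        funext ℓ
        by_cases h : ℓ < j
        · rw [if_pos h, if_pos h, hzz' (τ ℓ) (hτ ℓ h)]
        · rw [if_neg h, if_neg h]
      rw [hfun]
    · -- the segment bound: `Σ_{y'} P_{E_Δ}(w, y') [Sat x y'] ≤ q`
      intro w
      refine ctu_segment_bound (fun y : Fin (Δ + 1) → (Fin m × Fin k → Fin n × Bool) => y 0)
        (fun y => y (Fin.last Δ)) w
        (fun y => ∏ t : Fin Δ, resampleKernel ε (y t.castSucc) (y t.succ)) _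
        (fun v : Fin m × Fin k → Fin n × Bool =>
          if (∀ i : Fin m, ∃ j' : Fin k, x (v (i, j')).1 = (v (i, j')).2) then (1 : ℝ) else 0)
        (fun y' => resampleKernel (1 - (1 - ε) ^ Δ) w y')
        ((1 - ((1 - (1 - ε) ^ Δ) / 2) ^ k) ^ m) ?_
        (fun y' => hPow ε Δ w y') (hSat n m k hn _ hE0 hE1 x w)
      intro y
      exact cmb_ite_congr Iff.rfl
  -- Step 3: the weighted count of low-entropy candidates
  have h3 : ∑ x : Fin n → Bool, resampleChainMass ε K
        (fun z : ℕ → (Fin m × Fin k → Fin n × Bool) =>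
          overlapCondEnt (fun ℓ => if ℓ < j then a (z (τ ℓ)) else x) j ≤ β)
      ≤ ((n : ℝ) + 1) ^ (2 ^ j) * Real.exp (n * β) := by
    refine hTotal ε hε0 hε1 K (Fin n → Bool)
      (fun (x : Fin n → Bool) (z : ℕ → (Fin m × Fin k → Fin n × Bool)) =>
        overlapCondEnt (fun ℓ => if ℓ < j then a (z (τ ℓ)) else x) j ≤ β) _ ?_
    intro z
    convert hCount n j hj (fun ℓ => a (z (τ ℓ))) β using 4
  -- Steps 1 and 4: the union bound over `x`, then chain everything
  calc resampleChainMass ε K (fun z : ℕ → (Fin m × Fin k → Fin n × Bool) =>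
        ∃ x : Fin n → Bool,
          (∀ i : Fin m, ∃ j' : Fin k, x (z (s + Δ) (i, j')).1 = (z (s + Δ) (i, j')).2) ∧
          overlapCondEnt (fun ℓ => if ℓ < j then a (z (τ ℓ)) else x) j ≤ β)
      ≤ ∑ x : Fin n → Bool, resampleChainMass ε K (fun z : ℕ → (Fin m × Fin k → Fin n × Bool) =>
          (∀ i : Fin m, ∃ j' : Fin k, x (z (s + Δ) (i, j')).1 = (z (s + Δ) (i, j')).2) ∧
            overlapCondEnt (fun ℓ => if ℓ < j then a (z (τ ℓ)) else x) j ≤ β) :=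
        hUnion ε hε0 hε1 K
          (fun (x : Fin n → Bool) (z : ℕ → (Fin m × Fin k → Fin n × Bool)) =>
            (∀ i : Fin m, ∃ j' : Fin k, x (z (s + Δ) (i, j')).1 = (z (s + Δ) (i, j')).2) ∧
              overlapCondEnt (fun ℓ => if ℓ < j then a (z (τ ℓ)) else x) j ≤ β)
    _ ≤ ∑ x : Fin n → Bool, (1 - ((1 - (1 - ε) ^ Δ) / 2) ^ k) ^ m *
          resampleChainMass ε K (fun z : ℕ → (Fin m × Fin k → Fin n × Bool) =>
            overlapCondEnt (fun ℓ => if ℓ < j then a (z (τ ℓ)) else x) j ≤ β) :=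
        Finset.sum_le_sum fun x _ => h2 x
    _ = (1 - ((1 - (1 - ε) ^ Δ) / 2) ^ k) ^ m *
          ∑ x : Fin n → Bool, resampleChainMass ε K
            (fun z : ℕ → (Fin m × Fin k → Fin n × Bool) =>
              overlapCondEnt (fun ℓ => if ℓ < j then a (z (τ ℓ)) else x) j ≤ β) :=
        (Finset.mul_sum _ _ _).symm
    _ ≤ (1 - ((1 - (1 - ε) ^ Δ) / 2) ^ k) ^ m * (((n : ℝ) + 1) ^ (2 ^ j) * Real.exp (n * β)) :=
        mul_le_mul_of_nonneg_left h3 hq0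

end Summit.PneNP.PneNP.Theorems
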